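import Summits.BirchSwinnertonDyer.BirchSwinnertonDyer.Theses.PrintX8VS
import Summits.BirchSwinnertonDyer.BirchSwinnertonDyer.Theorems.SignedLowerHalvesSprungLowerDivisibilityAtThreeBothColours
import HarnessLib

/-!
# Route `PrintX8VS`, child C3 `ChromaticBothColoursPosRankX8` (stmt-BirchSwinnertonDyer-26783) of the crux
# `SprungLowerDivisibilityAtThree` (stmt-BirchSwinnertonDyer-19875) — CLOSED by name

Both colours `L♯, L♭ ≠ 0` on class X8 in positive analytic rank (Sprung 2017 Conj. 4.12 on X8): the route
declaration, literally, from the class-wide input-free theorem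
`ChromaticBothColours.ClassX8.sharp_ne_zero_and_flat_ne_zero` (trace-coordinate functional equation, now a
kernel theorem, + the row-twist non-vanishing of `ℒ(3, ±3)` + THEOREM B). Width seat
`cruxlead-stmt-BirchSwinnertonDyer-19875-w3` (gen 2). HONEST FRAMING: closes C3 only; K1 / BSD / leaf X8 are
NOT proved; no summit statement is proved.
-/

set_option autoImplicit false

noncomputable section

namespace Summit.BirchSwinnertonDyer.BirchSwinnertonDyer.Theorems

/-- **x8 child C3 `ChromaticBothColoursPosRankX8` holds** (stmt-BirchSwinnertonDyer-26783): the route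
declaration by name, from `ChromaticBothColours.ClassX8.sharp_ne_zero_and_flat_ne_zero` (the rank binder is
idle). [cite: Sprung2017, Conj. 4.12, Thm. 1.1, Thm. 4.13, Cor. 4.14] -/
theorem chromaticBothColoursPosRankX8_proof :
    Summit.BirchSwinnertonDyer.BirchSwinnertonDyer.Theses.PrintX8VS.ChromaticBothColoursPosRankX8 := by
  unfold Summit.BirchSwinnertonDyer.BirchSwinnertonDyer.Theses.PrintX8VS.ChromaticBothColoursPosRankX8
  intro W _ _ p _ hX _ N hN f Lsharp Lflat hf hSP
  exact ChromaticBothColours.ClassX8.sharp_ne_zero_and_flat_ne_zero W p hX N hN f Lsharp Lflat hf hSP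

end Summit.BirchSwinnertonDyer.BirchSwinnertonDyer.Theorems

end
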